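import Mathlib
import Summits.NavierStokesRegularity.NavierStokesRegularity.Theorems.ScalingDefectPeepholeDoorThreeCircles
import Summits.NavierStokesRegularity.NavierStokesRegularity.Theorems.CalmPocketDoorDefs
import HarnessLib

/-!
# Door S32 «CalmPocketDoor» (ROUND-30, nsreg-p1), optional plate · THE TWO-SEGMENT LEMMA (effective engine of Q32)

S-door lane of the cell `ns-regularity-ideate` (LEAD ns-s30-p1 g2; texts of record `r30/Sketch32.lean` v2 sha16 d8e333116c9f1838,
defs landed as `CalmPocketDoorDefs`, P0).  `TwoSegmentLemma`: there are absolute constants `C > 0`, `0 < θ < 1` such that a function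
`g` holomorphic on the disc `D(0, 16ρ)` and bounded by `K` there, which is `≤ η` (`0 < η ≤ K`) on the real segment `[−ρ, ρ]`, is
`≤ C K^{1−θ} η^{θ}` on the doubled segment `[−2ρ, 2ρ]`.

Proof (three tree lemmas of door S30's tube-propagation chain, no Taylor/Chebyshev bookkeeping): with `Λ = 1 − (2/π)arctan(4/3) ∈ (0,1]`,
(1) TWO CONSTANTS on the disc `D̄(0,ρ)` from its real diameter (`ScalingDefectPeepholeDoor.norm_le_two_constants_of_real_diameter`):
`‖g‖ ≤ m₁ := η^{Λ} K^{1−Λ}` on `D̄(0, ρ/2)`; (2) HADAMARD THREE CIRCLES, halving form (`ScalingDefectPeepholeDoor.norm_le_sqrt_of_small_disc`)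
with radii `ρ/2 ≤ ρ ≤ 2ρ`: `‖g‖ ≤ m₂ := √(m₁K)` on `D̄(0, ρ)`; (3) the same with radii `ρ ≤ 2ρ ≤ 4ρ`: `‖g‖ ≤ √(m₂K) = K^{1−Λ/4} η^{Λ/4}` on
`D̄(0, 2ρ) ⊇ [−2ρ, 2ρ]`.  Hence `(C, θ) = (1, Λ/4)`.

* `norm_le_of_twoSegment` — the disc form (`‖w‖ ≤ 2ρ`);
* `twoSegmentLemma_holds : TwoSegmentLemma` — the plate BY NAME.

WHAT THIS IS NOT: not NS regularity, not 0056 — pure one-variable complex analysis; an OPTIONAL plate of door S32 (a criterion conditional on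
Barker–Prange 2021 Prop. 10), making the pocket → shell propagation effective; `--supports` stmt-0056 as a helper.
[cite: Ransford1995, Thm. 4.3.7 (two-constants theorem); Conway1978, VI.3.13 (Hadamard three circles)]
-/

noncomputable section

set_option linter.dupNamespace false

open Set Filter Topology Metric Complex Real

namespace Summit.NavierStokesRegularity.NavierStokesRegularity.Theorems.CalmPocketDoor

open Summit.NavierStokesRegularity.NavierStokesRegularity.Theorems.ScalingDefectPeepholeDoor
  (norm_le_sqrt_of_small_disc norm_le_two_constants_of_real_diameter twoConstantsExp_pos twoConstantsExp_le_one)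

/-- **Two-segment estimate, disc form.**  `g` holomorphic on `D(0,16ρ)` with `‖g‖ ≤ K` there and `‖g t‖ ≤ η` for real `|t| ≤ ρ`
(`0 < η ≤ K`) satisfies `‖g w‖ ≤ K^{1−Λ/4} η^{Λ/4}` for `‖w‖ ≤ 2ρ`, `Λ = 1 − (2/π)arctan(4/3)`.
[cite: Ransford1995, Thm. 4.3.7; Conway1978, VI.3.13] -/
theorem norm_le_of_twoSegment {g : ℂ → ℂ} {ρ K η : ℝ} (hρ : 0 < ρ) (hη : 0 < η) (hηK : η ≤ K)
    (hg : DifferentiableOn ℂ g (ball (0 : ℂ) (16 * ρ))) (hK : ∀ z ∈ ball (0 : ℂ) (16 * ρ), ‖g z‖ ≤ K)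
    (hsmall : ∀ t : ℝ, |t| ≤ ρ → ‖g t‖ ≤ η) {w : ℂ} (hw : ‖w‖ ≤ 2 * ρ) :
    ‖g w‖ ≤ K ^ (1 - (1 - 2 / π * Real.arctan (4 / 3)) / 4) * η ^ ((1 - 2 / π * Real.arctan (4 / 3)) / 4) := by
  set Λ : ℝ := 1 - 2 / π * Real.arctan (4 / 3) with hΛ
  have hΛ0 : 0 < Λ := twoConstantsExp_pos
  have hK0 : 0 < K := hη.trans_le hηK
  have hKdisc : ∀ r : ℝ, r < 16 * ρ → ∀ z : ℂ, ‖z - 0‖ ≤ r → ‖g z‖ ≤ K := fun r hr z hz =>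
    hK z (by rw [mem_ball, dist_zero_right]; rw [sub_zero] at hz; linarith)
  -- step 1: two constants on `D̄(0, ρ)` from the real diameter
  set m₁ : ℝ := η ^ Λ * K ^ (1 - Λ) with hm₁
  have h1 : ∀ z : ℂ, ‖z - 0‖ ≤ ρ / 2 → ‖g z‖ ≤ m₁ := by
    intro z hz
    have hg' : DifferentiableOn ℂ g (ball ((0 : ℝ) : ℂ) (16 * ρ)) := by rwa [Complex.ofReal_zero]
    have h := norm_le_two_constants_of_real_diameter (c := (0 : ℝ)) (R := ρ) (R₃ := 16 * ρ) (m := η) (K := K)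
      hρ (by linarith) hg' hη.le hηK
      (fun z' hz' => hKdisc ρ (by linarith) z' (by simpa using hz'))
      (fun x hx => hsmall x (by rw [sub_zero] at hx; exact hx.le)) (w := z) (by simpa using hz)
    have e : (2 / π * Real.arctan (4 / 3) : ℝ) = 1 - Λ := by rw [hΛ]; ring
    rw [e, sub_sub_cancel] at h
    exact h
  have hm₁0 : 0 < m₁ := mul_pos (Real.rpow_pos_of_pos hη _) (Real.rpow_pos_of_pos hK0 _)
  have hm₁K : m₁ ≤ K := by
    have h1' : η ^ Λ ≤ K ^ Λ := Real.rpow_le_rpow hη.le hηK hΛ0.le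
    calc m₁ = η ^ Λ * K ^ (1 - Λ) := rfl
      _ ≤ K ^ Λ * K ^ (1 - Λ) := mul_le_mul_of_nonneg_right h1' (Real.rpow_nonneg hK0.le _)
      _ = K := by rw [← Real.rpow_add hK0, add_sub_cancel, Real.rpow_one]
  -- step 2: three circles with radii `ρ/2 ≤ ρ ≤ 2ρ`
  set m₂ : ℝ := Real.sqrt (m₁ * K) with hm₂
  have h2 : ∀ z : ℂ, ‖z - 0‖ ≤ ρ → ‖g z‖ ≤ m₂ := by
    intro z hz
    exact norm_le_sqrt_of_small_disc (c := (0 : ℂ)) (R := 2 * ρ) (R₃ := 16 * ρ) (m := m₁) (K := K) (by linarith) (by linarith)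
      hg hm₁0 hm₁K (fun z' hz' => hKdisc (2 * ρ) (by linarith) z' hz') (fun z' hz' => h1 z' (by linarith)) (w := z) (by linarith)
  have hm₂0 : 0 < m₂ := Real.sqrt_pos.2 (mul_pos hm₁0 hK0)
  have hm₂K : m₂ ≤ K := by
    calc m₂ = Real.sqrt (m₁ * K) := rfl
      _ ≤ Real.sqrt (K * K) := Real.sqrt_le_sqrt (mul_le_mul_of_nonneg_right hm₁K hK0.le)
      _ = K := Real.sqrt_mul_self hK0.le
  -- step 3: three circles with radii `ρ ≤ 2ρ ≤ 4ρ`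
  have h3 : ‖g w‖ ≤ Real.sqrt (m₂ * K) :=
    norm_le_sqrt_of_small_disc (c := (0 : ℂ)) (R := 4 * ρ) (R₃ := 16 * ρ) (m := m₂) (K := K) (by linarith) (by linarith)
      hg hm₂0 hm₂K (fun z' hz' => hKdisc (4 * ρ) (by linarith) z' hz') (fun z' hz' => h2 z' (by linarith)) (w := w)
      (by rw [sub_zero]; linarith)
  -- arithmetic: `√(m₂ K) = K^{1−Λ/4} η^{Λ/4}`
  have hval : Real.sqrt (m₂ * K) = K ^ (1 - Λ / 4) * η ^ (Λ / 4) := by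
    have hηΛ : 0 ≤ η ^ Λ := Real.rpow_nonneg hη.le _
    have e1 : m₁ * K = η ^ Λ * K ^ (2 - Λ) := by
      rw [hm₁, mul_assoc, ← Real.rpow_add_one hK0.ne']
      ring_nf
    have e2 : m₂ = η ^ (Λ / 2) * K ^ ((2 - Λ) / 2) := by
      rw [hm₂, e1, Real.sqrt_eq_rpow, Real.mul_rpow hηΛ (Real.rpow_nonneg hK0.le _), ← Real.rpow_mul hη.le,
        ← Real.rpow_mul hK0.le]
      ring_nf
    have e3 : m₂ * K = η ^ (Λ / 2) * K ^ ((2 - Λ) / 2 + 1) := by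
      rw [e2, mul_assoc, ← Real.rpow_add_one hK0.ne']
    rw [e3, Real.sqrt_eq_rpow, Real.mul_rpow (Real.rpow_nonneg hη.le _) (Real.rpow_nonneg hK0.le _), ← Real.rpow_mul hη.le,
      ← Real.rpow_mul hK0.le, mul_comm]
    ring_nf
  rw [hval] at h3
  exact h3

/-- **THE TWO-SEGMENT LEMMA (`TwoSegmentLemma`, door S32, BY NAME)** with `(C, θ) = (1, Λ/4)`, `Λ = 1 − (2/π)arctan(4/3)`: a function
holomorphic on `D(0, 16ρ)`, bounded by `K` there and `≤ η` on `[−ρ, ρ]` (`0 < η ≤ K`) is `≤ K^{1−θ} η^{θ}` on `[−2ρ, 2ρ]`.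
[cite: Ransford1995, Thm. 4.3.7; Conway1978, VI.3.13] -/
theorem twoSegmentLemma_holds : TwoSegmentLemma := by
  refine ⟨1, (1 - 2 / π * Real.arctan (4 / 3)) / 4, one_pos, by linarith [twoConstantsExp_pos],
    by linarith [twoConstantsExp_le_one], ?_⟩
  intro g ρ K η hρ hη hηK hg hK hsmall t ht
  rw [one_mul]
  exact norm_le_of_twoSegment hρ hη hηK hg hK hsmall (w := (t : ℂ)) (by rw [Complex.norm_real, Real.norm_eq_abs]; exact ht)

end Summit.NavierStokesRegularity.NavierStokesRegularity.Theorems.CalmPocketDoor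

end
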